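import Summits.AtomisticToContinuum.FouriersLaw.Theorems.BondHeatUncertaintyBoundedResponseTransientBandB

/-!
# `TransientBand` — the blocker `BoundedResponse` (11071) split at the Thouless time by the escape transient (lens-1 g92 node B) — part 3 of 5 (sequel of `…BondHeatUncertaintyBoundedResponseTransientBandB`)

Split for the 400-line cap by the landing lane (hand-2 g35); the module docstring of part 1 (`…BondHeatUncertaintyBoundedResponseTransientBandA`) describes the whole node.  Same namespace; all FQNs unchanged.
0 sorry; standard axioms.
-/

noncomputable section
open MeasureTheory Filter Topology Set
open Literature.MathematicalPhysics.KineticTheory.HeatConduction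

namespace Summit.AtomisticToContinuum.FouriersLaw.Theorems.BoundedResponse.TransientBand

open Summit.AtomisticToContinuum.FouriersLaw.Theses.BondHeatUncertainty (BoundedResponse)
open Summit.AtomisticToContinuum.FouriersLaw.Theses.GriffithsLimitExchange (BoundaryDEP)
open Summit.AtomisticToContinuum.FouriersLaw.Theorems.SubdiffusiveBondHeat
  (boundaryKernelBasics_proof pinnedChain_primitive_kinKernel_integral_eq escapeDeficit_nonneg escapeDeficit_le_one
    boundedResponse_iff_ohmicFloor)
open Summit.AtomisticToContinuum.FouriersLaw.Theorems.SubdiffusiveBondHeat.EscapeGrading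
  (escapeDeficit OhmicFloor ExponentFloor ohmicFloor_iff_boundedResponse exponentFloor_one_iff_ohmicFloor)
open Summit.AtomisticToContinuum.FouriersLaw.Theorems.BoundedResponse.TransientContact (contactImbalanceCorr)

/-! ## §6 The junction side: the contact surplus of node A IS `γ·Ov_N` up to statics -/

/-- The equilibrium energy autocorrelation `R_H^N(τ) = ∫ (H − ⟨H⟩)·P_τ(H − ⟨H⟩) dμ_T` (`R_H(0) = Var_{μ_T}(H_N)`). [folklore] -/
def energyAutocorr (P : OscillatorChain) (T : ℝ) (N : ℕ) (τ : ℝ) : ℝ :=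
  ∫ z, (P.hamiltonian N z - ∫ x, P.hamiltonian N x ∂(P.gibbsMeasure N T)) *
      (∫ y, (P.hamiltonian N y - ∫ x, P.hamiltonian N x ∂(P.gibbsMeasure N T)) ∂(P.transitionKernel N T T τ.toNNReal z))
    ∂(P.gibbsMeasure N T)

/-- **`SurplusTransientIdentity` (EI)** — the fixed-`N` identity joining the two currencies:
`s_N(τ) := T² ∫_{(0,∞)} min(u,τ) C^g_N(u) du = γ·Ov_N(τ) − (R_H(0) − R_H(τ))/(4T²)` (`N ≥ 2`, `τ ≥ 0`), where `C^g_N` is the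
contact-imbalance autocorrelation of `…TransientContactBudget` and `s_N` the contact surplus of node A.  Derivation (paper):
`C^g = (γ/2T²)²·(4K_N − Σ_N)` (parallelogram law, reflection symmetry `K_0 = K_{N−1}`, reversibility for the cross terms),
`Σ_N = ⟨h, P_u h⟩` with `h = p₀² + p_{N−1}² − 2T = −(L H)/γ`, hence `Σ_N = R_H''/γ²` (Dynkin twice + time reversal, `H`, `h`
momentum-even) and `∫ min(u,τ) Σ_N = (R_H(0) − R_H(τ))/γ²` (two integrations by parts, `R_H' → 0`).  VERIFIED in the exactly
solvable member (`lam = β = 0`, Lyapunov/matrix-exponential evaluation, 7 parameter sets, agreement `1e-4`, `num/identity_check.py`).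
Tags: fixed-`N` identity · WEAKER(evidence) · ATTACKABLE·L (Dynkin ×2 for polynomially bounded observables, kernel reversibility,
Fubini). (piece · fixed-N) [route statement · this cell; NOT a literature fact] -/
def SurplusTransientIdentity : Prop :=
  ∀ ω₂ lam β γ : ℝ, 0 < ω₂ → 0 < lam → 0 < β → 0 < γ → ∀ T : ℝ, 0 < T → ∀ N : ℕ, 2 ≤ N → ∀ τ : ℝ, 0 ≤ τ →
    T ^ 2 * (∫ u in Set.Ioi (0 : ℝ), min u τ * contactImbalanceCorr (pinnedChain ω₂ lam β γ) T N u) =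
      γ * escapeTransient ω₂ lam β γ T N τ -
        (energyAutocorr (pinnedChain ω₂ lam β γ) T N 0 - energyAutocorr (pinnedChain ω₂ lam β γ) T N τ) / (4 * T ^ 2)

/-- **`EnergyCorrelationDropLinear`** — statics: `|R_H(0) − R_H(τ)| ≤ C_H·N` for `N ≥ 2`, `τ ≥ 0` (`|R_H(τ)| ≤ R_H(0) = Var_{μ_T}(H_N)`
by Cauchy–Schwarz and invariance; `Var_{μ_T}(H_N) = O(N)` by decay of correlations of the one-dimensional Gibbs measure —
the same statics as `ExtensiveBlockEnergyVariance` of node g91).  Tags: WEAKER · ATTACKABLE·L.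
(piece · statics) [route statement · this cell; NOT a literature fact] -/
def EnergyCorrelationDropLinear : Prop :=
  ∀ ω₂ lam β γ : ℝ, 0 < ω₂ → 0 < lam → 0 < β → 0 < γ → ∀ T : ℝ, 0 < T →
    ∃ C_H : ℝ, ∀ N : ℕ, 2 ≤ N → ∀ τ : ℝ, 0 ≤ τ →
      |energyAutocorr (pinnedChain ω₂ lam β γ) T N 0 - energyAutocorr (pinnedChain ω₂ lam β γ) T N τ| ≤ C_H * N

/-- **`ContactSurplusFloor`** — node A's `EquilibriumSurplusFloor` in eventually-form: `∀ c > 0 ∃ C N₀ ∀ N ≥ N₀,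
s_N(cN²) ≥ −C·N`. (piece · rung) [route statement · this cell; NOT a literature fact] -/
def ContactSurplusFloor : Prop :=
  ∀ ω₂ lam β γ : ℝ, 0 < ω₂ → 0 < lam → 0 < β → 0 < γ → ∀ T : ℝ, 0 < T → ∀ c : ℝ, 0 < c →
    ∃ C : ℝ, ∃ N₀ : ℕ, ∀ N : ℕ, N₀ ≤ N →
      -(C * (N : ℝ)) ≤ T ^ 2 * (∫ u in Set.Ioi (0 : ℝ),
        min u (c * (N : ℝ) ^ 2) * contactImbalanceCorr (pinnedChain ω₂ lam β γ) T N u)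

/-- **The two gradings meet**: under (EI) and the statics, the contact-surplus floor of node A and the escape-transient floor
`TransientFloor 1` are EQUIVALENT.  So node A's Green–Kubo hypothesis, TUR budget and bond-heat variance are all unnecessary for
the blocker: the junction surplus and the escape transient are one object. [folklore] -/
theorem contactSurplusFloor_iff_transientFloor_one (hI : SurplusTransientIdentity) (hV : EnergyCorrelationDropLinear) :
    ContactSurplusFloor ↔ TransientFloor 1 := by
  constructor
  · intro hS ω₂ lam β γ hω hl hβ hγ T hT c hc
    obtain ⟨C, N₀, hs⟩ := hS ω₂ lam β γ hω hl hβ hγ T hT c hc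
    obtain ⟨C_H, hR⟩ := hV ω₂ lam β γ hω hl hβ hγ T hT
    refine ⟨(C + C_H / (4 * T ^ 2)) / γ, max N₀ 2, fun N hN => ?_⟩
    have hN₀ : N₀ ≤ N := le_trans (le_max_left _ _) hN
    have hN2 : 2 ≤ N := le_trans (le_max_right _ _) hN
    have ht : (0 : ℝ) ≤ c * (N : ℝ) ^ 2 := by positivity
    have h1 := hs N hN₀
    have h2 := abs_le.mp (hR N hN2 _ ht)
    have h3 := hI ω₂ lam β γ hω hl hβ hγ T hT N hN2 _ ht
    rw [Real.rpow_one]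
    set Ov := escapeTransient ω₂ lam β γ T N (c * (N : ℝ) ^ 2)
    set Δ := energyAutocorr (pinnedChain ω₂ lam β γ) T N 0 -
      energyAutocorr (pinnedChain ω₂ lam β γ) T N (c * (N : ℝ) ^ 2)
    have hT2 : (0 : ℝ) < 4 * T ^ 2 := by positivity
    have hΔ : -(C_H / (4 * T ^ 2) * N) ≤ Δ / (4 * T ^ 2) := by
      rw [div_mul_eq_mul_div, ← neg_div, div_le_div_iff_of_pos_right hT2]; exact h2.1
    have key : -((C + C_H / (4 * T ^ 2)) * N) ≤ γ * Ov := by nlinarith [h1, h3, hΔ]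
    rw [show -((C + C_H / (4 * T ^ 2)) / γ * (N : ℝ)) = -((C + C_H / (4 * T ^ 2)) * N) / γ by ring,
      div_le_iff₀ hγ]
    linarith [mul_comm γ Ov]
  · intro hF ω₂ lam β γ hω hl hβ hγ T hT c hc
    obtain ⟨C', N₀, hOv⟩ := hF ω₂ lam β γ hω hl hβ hγ T hT c hc
    obtain ⟨C_H, hR⟩ := hV ω₂ lam β γ hω hl hβ hγ T hT
    refine ⟨γ * C' + C_H / (4 * T ^ 2), max N₀ 2, fun N hN => ?_⟩
    have hN₀ : N₀ ≤ N := le_trans (le_max_left _ _) hN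
    have hN2 : 2 ≤ N := le_trans (le_max_right _ _) hN
    have ht : (0 : ℝ) ≤ c * (N : ℝ) ^ 2 := by positivity
    have h1 := hOv N hN₀
    rw [Real.rpow_one] at h1
    have h2 := abs_le.mp (hR N hN2 _ ht)
    have h3 := hI ω₂ lam β γ hω hl hβ hγ T hT N hN2 _ ht
    set Ov := escapeTransient ω₂ lam β γ T N (c * (N : ℝ) ^ 2)
    set Δ := energyAutocorr (pinnedChain ω₂ lam β γ) T N 0 -
      energyAutocorr (pinnedChain ω₂ lam β γ) T N (c * (N : ℝ) ^ 2)
    have hT2 : (0 : ℝ) < 4 * T ^ 2 := by positivity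
    have hΔ : Δ / (4 * T ^ 2) ≤ C_H / (4 * T ^ 2) * N := by
      rw [div_mul_eq_mul_div, div_le_div_iff_of_pos_right hT2]; exact h2.2
    rw [h3]
    nlinarith [h1, hΔ, hγ]

/-- Hence **`DeficitCesaroPoint ∧ ContactSurplusFloor ⟹ BoundedResponse`** modulo (EI) and the statics — node A's door with its
bracket `{K_T, W, (S), GK}` replaced by `{(EI), statics}` and `(S)` by the one-time stub (D). [folklore] -/
theorem boundedResponse_of_deficitCesaroPoint_contactSurplusFloor (hI : SurplusTransientIdentity)
    (hV : EnergyCorrelationDropLinear) : DeficitCesaroPoint → ContactSurplusFloor → BoundedResponse := fun hD hS =>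
  boundedResponse_of_deficitCesaroPoint_transientFloor hD ((contactSurplusFloor_iff_transientFloor_one hI hV).mp hS)

/-! ## §8 The band in the SPECTRUM: the two one-sided Warburg cusps of the boundary noise spectrum

With the tree's WARBURG DIP `M_N(ω) = (γ/T²)∫_{(0,∞)}(1 − cos ωu) K_N(u) du = (γ/2T²)(s_N(0) − s_N(ω))` (the dip of the
boundary noise spectrum `s_N(ω) = 2∫₀^∞ cos(ωu)K_N` below its DC value; `…SubdiffusiveBondHeatSpectralNonneg`,
`…OfContactWarburgModulus`) and the tree's spectral representation of the `min` kernel (`integral_min_mul_eq_spectral`):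
    c₁ · Ov_N(t) = ∫_{(0,∞)} (1 − cos ωt) ω⁻² M_N(ω) dω        (`escapeTransient_eq_spectral`, c₁ = ∫(1 − cos ω)/ω² > 0).
Hence the two sides of the bracket of §3 are the two ONE-SIDED `√|ω|` cusps of `s_N` at DC, uniformly in `N`:
* the UPPER cusp `M_N(ω) ≤ C√|ω|` (`WarburgDipCusp` = VERBATIM the strategist's `ContactWarburgModulus` of crux 9120, whose
  transfer `⟹ TransientEW` is LANDED: `transientEW_of_contactWarburgModulus`) gives the ceiling (U)
  (`transientCeilingPoint_of_warburgDipCusp`);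
* the LOWER cusp `M_N(ω) ≥ −A√|ω|` (`WarburgDipFloor`, NEW, the mirror image; phonon-true since `M_N^{harm} ≥ 0`) gives the floor
  (F₁) (`transientFloor_one_of_warburgDipFloor`) — its high band `ω > 1` is FREE (`escapeHighBand_ge`: Bochner positivity of
  `K_N` in Fejér form, landed as `lagIntegral_cos_kinCorr_nonneg`, + a Fejér average; constant `32c₁T²`);
* the SIGN rung `M_N(ω) ≥ 0` for all `ω` (`WarburgDipNonneg`: «the boundary noise spectrum PEAKS AT DC», fixed-`N`, `N`-free,
  ⟸ `BoundaryDEP` trivially, phonon-true) gives `Ov_N ≥ 0` at all times, hence `TransientFloor g` for EVERY `g` and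
  `DeficitCesaroFloor` with constant `0`;
so that **under the two-sided `N`-uniform Warburg (Hölder-½) modulus of `s_N` at DC, `BoundedResponse ⟺ DeficitCesaroPoint`**
(`boundedResponse_iff_deficitCesaroPoint_of_warburgModulus`): 11071 is EXACTLY «Edwards–Wilkinson at the Thouless time».
The abstract kernel lemmas of this section are namespace-local copies of node A «SurplusSpectrum»'s (same statements). -/

/-! ### Abstract kernel lemmas (copies of node A's `…TransientContact.integral_min_mul_ge_of_floor` and § HighBandFree) -/

open Summit.AtomisticToContinuum.FouriersLaw.Theorems.SubdiffusiveBondHeat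

/-- **Spectral floor ⟹ `√t` floor** (the mirror image of `transientTail_le_sqrt_of_warburg`).  Let `K` be
measurable and integrable on `(0,∞)` with dip `D_K(ω) = ∫_{(0,∞)} (1 − cos ωu) K(u) du`.  If
`D_K(ω) ≥ −A√ω` on `(0,1]` (infrared floor) and, at the time `t ≥ 1`, the high band carries
`∫_{(1,∞)} (1 − cos ωt) ω⁻² D_K(ω) dω ≥ −B`, then
`∫_{(0,∞)} min(u,t) K(u) du ≥ −((max A 0)·c₂ + max B 0)/c₁ · √t`. [folklore] -/
theorem integral_min_mul_ge_of_floor {K : ℝ → ℝ} (hKm : Measurable K)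
    (hKi : IntegrableOn K (Ioi 0)) {A B t : ℝ} (ht : 1 ≤ t)
    (hF : ∀ ω : ℝ, 0 < ω → ω ≤ 1 →
      -(A * Real.sqrt ω) ≤ ∫ u in Ioi 0, (1 - Real.cos (ω * u)) * K u)
    (hH : -B ≤
      ∫ ω in Ioi 1,
        (1 - Real.cos (ω * t)) / ω ^ 2 * ∫ u in Ioi 0, (1 - Real.cos (ω * u)) * K u) :
    -(((max A 0) * (∫ v in Ioi (0 : ℝ), (1 - Real.cos v) / (v * Real.sqrt v)) + max B 0) /
        (∫ ω in Ioi (0 : ℝ), (1 - Real.cos ω) / ω ^ 2) * Real.sqrt t) ≤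
      ∫ u in Ioi 0, min u t * K u := by
  set c₁ : ℝ := ∫ ω in Ioi (0 : ℝ), (1 - Real.cos ω) / ω ^ 2 with hc₁
  set c₂ : ℝ := ∫ v in Ioi (0 : ℝ), (1 - Real.cos v) / (v * Real.sqrt v) with hc₂
  set A' : ℝ := max A 0 with hA'
  set B' : ℝ := max B 0 with hB'
  have ht0 : 0 < t := lt_of_lt_of_le one_pos ht
  have hc₁ : 0 < c₁ := integral_one_sub_cos_div_sq_pos
  have hc₂ : 0 ≤ c₂ := integral_one_sub_cos_div_mul_sqrt_nonneg
  have hA'0 : 0 ≤ A' := le_max_right _ _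
  have hB'0 : 0 ≤ B' := le_max_right _ _
  set D : ℝ → ℝ := fun ω => ∫ u in Ioi 0, (1 - Real.cos (ω * u)) * K u with hD
  set F : ℝ → ℝ := fun ω => (1 - Real.cos (ω * t)) / ω ^ 2 * D ω with hFdef
  have hid : c₁ * ∫ u in Ioi 0, min u t * K u = ∫ ω in Ioi 0, F ω :=
    integral_min_mul_eq_spectral hKm hKi ht0.le
  have hFi : IntegrableOn F (Ioi 0) := integrableOn_spectralIntegrand hKm hKi ht0.le
  -- split the frequency axis at `ω = 1`
  have hsplit : ∫ ω in Ioi 0, F ω = (∫ ω in Ioc 0 1, F ω) + ∫ ω in Ioi 1, F ω := by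
    rw [← Ioc_union_Ioi_eq_Ioi zero_le_one]
    exact setIntegral_union Ioc_disjoint_Ioi_same measurableSet_Ioi
      (hFi.mono_set Ioc_subset_Ioi_self) (hFi.mono_set (Ioi_subset_Ioi zero_le_one))
  -- the infrared band
  set b : ℝ → ℝ := fun ω => A' * ((1 - Real.cos (ω * t)) / (ω * Real.sqrt ω)) with hb
  have hbi : IntegrableOn b (Ioi 0) := (integrableOn_one_sub_cos_mul_div_mul_sqrt ht0).const_mul _
  have hbnn : ∀ ω ∈ Ioi (0 : ℝ), 0 ≤ b ω := by
    intro ω hω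
    have hω : (0 : ℝ) < ω := hω
    exact mul_nonneg hA'0 (div_nonneg (one_sub_cos_mem_Icc (ω * t)).1
      (mul_nonneg hω.le (Real.sqrt_nonneg _)))
  have hlow_pt : ∀ ω ∈ Ioc (0 : ℝ) 1, -b ω ≤ F ω := by
    intro ω hω
    have hω0 : (0 : ℝ) < ω := hω.1
    have hsω : 0 < Real.sqrt ω := Real.sqrt_pos.2 hω0
    have h1 := one_sub_cos_mem_Icc (ω * t)
    have hq : 0 ≤ (1 - Real.cos (ω * t)) / ω ^ 2 := div_nonneg h1.1 (sq_nonneg _)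
    have hw : -(A' * Real.sqrt ω) ≤ D ω := by
      have := hF ω hω0 hω.2
      have hAA : A * Real.sqrt ω ≤ A' * Real.sqrt ω :=
        mul_le_mul_of_nonneg_right (le_max_left _ _) hsω.le
      linarith
    have hω2 : ω ^ 2 = ω * Real.sqrt ω * Real.sqrt ω := by
      rw [mul_assoc, Real.mul_self_sqrt hω0.le]; ring
    calc -b ω = (1 - Real.cos (ω * t)) / ω ^ 2 * (-(A' * Real.sqrt ω)) := by
            rw [hb, hω2]; field_simp
      _ ≤ (1 - Real.cos (ω * t)) / ω ^ 2 * D ω := mul_le_mul_of_nonneg_left hw hq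
      _ = F ω := by rw [hFdef]
  have hlow : -(A' * (Real.sqrt t * c₂)) ≤ ∫ ω in Ioc 0 1, F ω := by
    have hmono : ∫ ω in Ioc 0 1, -b ω ≤ ∫ ω in Ioc 0 1, F ω :=
      setIntegral_mono_on (hbi.mono_set Ioc_subset_Ioi_self).neg (hFi.mono_set Ioc_subset_Ioi_self)
        measurableSet_Ioc hlow_pt
    have hsub : ∫ ω in Ioc 0 1, b ω ≤ ∫ ω in Ioi 0, b ω :=
      setIntegral_mono_set hbi (ae_restrict_of_forall_mem measurableSet_Ioi hbnn)
        (Eventually.of_forall Ioc_subset_Ioi_self)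
    have hbint : ∫ ω in Ioi 0, b ω = A' * (Real.sqrt t * c₂) := by
      simp only [hb]
      rw [integral_const_mul, integral_one_sub_cos_mul_div_mul_sqrt ht0]
    rw [integral_neg] at hmono
    linarith
  -- assemble
  have hst : 1 ≤ Real.sqrt t := by rw [← Real.sqrt_one]; exact Real.sqrt_le_sqrt ht
  have hBB : -B' * Real.sqrt t ≤ -B := by
    have : B ≤ B' := le_max_left _ _
    nlinarith
  have htot : -((A' * c₂ + B') * Real.sqrt t) ≤ c₁ * ∫ u in Ioi 0, min u t * K u := by
    rw [hid, hsplit]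
    have hH' : -B ≤ ∫ ω in Ioi 1, F ω := hH
    nlinarith
  have hfin : -((A' * c₂ + B') * Real.sqrt t) / c₁ ≤ ∫ u in Ioi 0, min u t * K u := by
    rw [div_le_iff₀ hc₁]
    linarith
  calc -((A' * c₂ + B') / c₁ * Real.sqrt t)
        = -((A' * c₂ + B') * Real.sqrt t) / c₁ := by ring
    _ ≤ ∫ u in Ioi 0, min u t * K u := hfin

end Summit.AtomisticToContinuum.FouriersLaw.Theorems.BoundedResponse.TransientBand

end
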